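import Literature.NumberTheory.GaloisRepresentations.FrobeniusPlaces
import Literature.NumberTheory.EllipticCurves.HeckeLFunctionEqLSeriesOfLocalFactors
import Literature.NumberTheory.QuadraticFields.KroneckerSplitting
import Literature.NumberTheory.LFunctions.RayClassCharacter
import Mathlib.NumberTheory.NumberField.Discriminant.Different
import HarnessLib

/-!
# Places of a number field above a rational prime: the `ℤ` / `𝓞 ℚ` dictionary (brick R4a of the odd-`p` theta partner)

Route `SignedLowerHalves`, child L `SmallImageLowerHalfBothSigns` (item stmt-BirchSwinnertonDyer-23599), line
proposal `rtt_w3`, stub K0₂@p `stub_heckeThetaPartner_ns` — brick R4a of the arithmetic half at an ODD prime (width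
seat `bsd-line-slh-p3-w3` gen 9; memo `Lines/birth_acns-MEMO-w3-g9.md`).  THEOREMS ONLY (no definition, no named
fact, no `sorry`); ROUTE-INDEPENDENT; pure algebraic number theory.

For a number field `K`, a rational prime `ℓ` and the place `v_ℓ` of `ℚ` (`primesEquiv v_ℓ = ℓ`):
* `v_ℓ = (ℓ)` in `𝓞 ℚ`, `v_ℓ𝓞_K = ℓ𝓞_K` (`asIdeal_eq_span_natCast`, `map_asIdeal_eq_span_natCast`);
* a prime `P` of `𝓞 K` lies over `(ℓ) ⊂ ℤ` iff over `v_ℓ ⊂ 𝓞 ℚ` iff `ℓ ∈ P`; the two `primesOver` sets agree and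
  the ramification indices over `ℤ` and over `𝓞 ℚ` agree (`ramificationIdx_int_eq`);
* **`ℓ ∤ d_K ⇒ v_ℓ` unramified in `K`** (`isUnramifiedIn_asIdeal_of_not_dvd_discr`, Mathlib's Dedekind discriminant
  theorem moved to the base `𝓞 ℚ` used by `…FrobeniusPlaces`);
* the multiplicities of `ℓ𝓞_K`: `1` at the places above `ℓ` (unramified), `0` elsewhere, hence
  `χ̃((ℓ)) = ∏_{w ∋ ℓ} χ(w)` for the ideal-power extension `LFunctions.idealPow` (`idealPow_span_natCast_eq_finprod`);
* for a quadratic field and odd `ℓ`: two places above `v_ℓ` iff `(d_K/ℓ) = 1`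
  (`natCard_placesOver_eq_two_iff_jacobiSym`, from `KroneckerSplitting.ncard_primesOver_eq_two_iff_jacobiSym`).

BSD, crux L and the stub are NOT proved here.

References: J. Neukirch, ANT I §8 (8.2)–(8.3), III §2 Cor. (2.12); D. A. Marcus, *Number Fields*, Ch. 3 Thm. 25.
-/

set_option autoImplicit false
set_option linter.dupNamespace false

noncomputable section

open scoped Classical NumberField
open IsDedekindDomain NumberField Literature.NumberTheory.EllipticCurves Literature.NumberTheory.GaloisRepresentations
  Rat.HeightOneSpectrum UniqueFactorizationMonoid Literature.NumberTheory.LFunctions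

namespace Summit.BirchSwinnertonDyer.BirchSwinnertonDyer.Theorems.SmallImageLambdaLowerThreeNsThetaPartner

/-! ### Places of `K` above a rational prime: the `ℤ` / `𝓞 ℚ` dictionary -/

section Places

variable {K : Type} [Field K] [NumberField K]

/-- `v_ℓ = (ℓ)` in `𝓞 ℚ`. [folklore] -/
theorem asIdeal_eq_span_natCast {v : HeightOneSpectrum (𝓞 ℚ)} {ℓ : ℕ} (hv : (primesEquiv v : ℕ) = ℓ) :
    v.asIdeal = Ideal.span {(ℓ : 𝓞 ℚ)} := by
  set E := Rat.IsIntegralClosure.intEquiv (𝓞 ℚ) with hE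
  have h1 : v.asIdeal = (Ideal.span {((natGenerator v : ℕ) : ℤ)}).comap E := by
    rw [span_natGenerator, Ideal.comap_map_of_bijective _ E.bijective]
  ext x
  rw [h1, Ideal.mem_comap, Ideal.mem_span_singleton, Ideal.mem_span_singleton, ← map_dvd_iff E, map_natCast, ← hv]
  rfl

/-- `v_ℓ 𝓞_K = (ℓ) 𝓞_K = ℓ𝓞_K`. [folklore] -/
theorem map_asIdeal_eq_span_natCast {v : HeightOneSpectrum (𝓞 ℚ)} {ℓ : ℕ} (hv : (primesEquiv v : ℕ) = ℓ) :
    v.asIdeal.map (algebraMap (𝓞 ℚ) (𝓞 K)) = Ideal.span {(ℓ : 𝓞 K)} := by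
  rw [asIdeal_eq_span_natCast hv, Ideal.map_span, Set.image_singleton, map_natCast]

omit [NumberField K] in
/-- `(ℓ)𝓞_K = ℓ𝓞_K` (base `ℤ`). [folklore] -/
theorem map_span_int_eq_span_natCast (ℓ : ℕ) :
    (Ideal.span {(ℓ : ℤ)}).map (algebraMap ℤ (𝓞 K)) = Ideal.span {(ℓ : 𝓞 K)} := by
  rw [Ideal.map_span, Set.image_singleton, map_natCast]

omit [NumberField K] in
/-- A prime of `𝓞 K` lies over `(ℓ) ⊂ ℤ` iff it contains `ℓ`. [folklore] -/
theorem liesOver_span_iff_natCast_mem {ℓ : ℕ} (hℓ : ℓ.Prime) (P : Ideal (𝓞 K)) [hP : P.IsPrime] :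
    P.LiesOver (Ideal.span {(ℓ : ℤ)}) ↔ (ℓ : 𝓞 K) ∈ P := by
  constructor
  · intro h
    have : (ℓ : ℤ) ∈ P.under ℤ := by rw [← h.over]; exact Ideal.mem_span_singleton_self _
    rw [Ideal.under_def, Ideal.mem_comap, map_natCast] at this
    exact this
  · intro h
    constructor
    have hmax : (Ideal.span {(ℓ : ℤ)}).IsMaximal :=
      ((Ideal.span_singleton_prime (by exact_mod_cast hℓ.ne_zero)).mpr
        (Nat.prime_iff_prime_int.mp hℓ)).isMaximal (by
          rw [Ne, Ideal.span_singleton_eq_bot]; exact_mod_cast hℓ.ne_zero)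
    refine (hmax.eq_of_le (Ideal.comap_ne_top _ hP.ne_top) ?_)
    rw [Ideal.span_le, Set.singleton_subset_iff, SetLike.mem_coe, Ideal.mem_comap, map_natCast]
    exact h

/-- A prime of `𝓞 K` lies over `v_ℓ ⊂ 𝓞 ℚ` iff it contains `ℓ`. [folklore] -/
theorem liesOver_asIdeal_iff_natCast_mem {v : HeightOneSpectrum (𝓞 ℚ)} {ℓ : ℕ} (hv : (primesEquiv v : ℕ) = ℓ)
    (P : Ideal (𝓞 K)) [hP : P.IsPrime] : P.LiesOver v.asIdeal ↔ (ℓ : 𝓞 K) ∈ P := by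
  have hℓ : ℓ.Prime := hv ▸ (primesEquiv v).2
  constructor
  · intro h
    have : (ℓ : 𝓞 ℚ) ∈ P.under (𝓞 ℚ) := by rw [← h.over, asIdeal_eq_span_natCast hv]; exact Ideal.mem_span_singleton_self _
    rw [Ideal.under_def, Ideal.mem_comap, map_natCast] at this
    exact this
  · intro h
    have hP0 : P ≠ ⊥ := by
      intro h0; rw [h0, Ideal.mem_bot, Nat.cast_eq_zero] at h; exact hℓ.ne_zero h
    set w : HeightOneSpectrum (𝓞 K) := ⟨P, hP, hP0⟩ with hw
    have hwv : w.under (𝓞 ℚ) = v := (under_eq_iff_natCast_primesEquiv_mem w v).mpr (by rw [hv]; exact h)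
    exact ⟨(congrArg HeightOneSpectrum.asIdeal hwv).symm⟩

/-- The primes of `𝓞 K` over `(ℓ) ⊂ ℤ` are the primes over `v_ℓ ⊂ 𝓞 ℚ`. [folklore] -/
theorem primesOver_span_eq_primesOver_asIdeal {v : HeightOneSpectrum (𝓞 ℚ)} {ℓ : ℕ}
    (hv : (primesEquiv v : ℕ) = ℓ) :
    (Ideal.span {(ℓ : ℤ)}).primesOver (𝓞 K) = v.asIdeal.primesOver (𝓞 K) := by
  have hℓ : ℓ.Prime := hv ▸ (primesEquiv v).2
  ext P
  constructor
  · rintro ⟨hP, hover⟩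
    haveI := hP
    exact ⟨hP, (liesOver_asIdeal_iff_natCast_mem hv P).mpr ((liesOver_span_iff_natCast_mem hℓ P).mp hover)⟩
  · rintro ⟨hP, hover⟩
    haveI := hP
    exact ⟨hP, (liesOver_span_iff_natCast_mem hℓ P).mpr ((liesOver_asIdeal_iff_natCast_mem hv P).mp hover)⟩

/-- The ramification index of a prime of `𝓞 K` above `ℓ` is the same over `ℤ` and over `𝓞 ℚ` (both are its
multiplicity in `ℓ𝓞_K`). [folklore] -/
theorem ramificationIdx_int_eq {v : HeightOneSpectrum (𝓞 ℚ)} {ℓ : ℕ} (hv : (primesEquiv v : ℕ) = ℓ)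
    (P : Ideal (𝓞 K)) [hP : P.IsPrime] [hPv : P.LiesOver v.asIdeal] :
    P.ramificationIdx ℤ = P.ramificationIdx (𝓞 ℚ) := by
  have hℓ : ℓ.Prime := hv ▸ (primesEquiv v).2
  haveI : P.LiesOver (Ideal.span {(ℓ : ℤ)}) :=
    (liesOver_span_iff_natCast_mem hℓ P).mpr ((liesOver_asIdeal_iff_natCast_mem hv P).mp hPv)
  have h0 : Ideal.span {(ℓ : 𝓞 K)} ≠ ⊥ := by
    rw [Ne, Ideal.span_singleton_eq_bot]; exact_mod_cast hℓ.ne_zero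
  rw [Ideal.IsDedekindDomain.ramificationIdx_eq_normalizedFactors_count (Ideal.span {(ℓ : ℤ)}) P
      (by rw [map_span_int_eq_span_natCast]; exact h0),
    Ideal.IsDedekindDomain.ramificationIdx_eq_normalizedFactors_count v.asIdeal P
      (by rw [map_asIdeal_eq_span_natCast hv]; exact h0),
    map_span_int_eq_span_natCast, map_asIdeal_eq_span_natCast hv]

/-- **`ℓ ∤ d_K ⇒ v_ℓ` is unramified in `K`** (Dedekind's discriminant theorem, Mathlib
`NumberField.not_dvd_discr_iff_isUnramifiedIn`, moved to the base `𝓞 ℚ`). [cite: NeukirchANT1999, Ch. III §2 Cor. (2.12)] -/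
theorem isUnramifiedIn_asIdeal_of_not_dvd_discr {v : HeightOneSpectrum (𝓞 ℚ)} {ℓ : ℕ}
    (hv : (primesEquiv v : ℕ) = ℓ) (hℓd : ¬ (ℓ : ℤ) ∣ NumberField.discr K) :
    Algebra.IsUnramifiedIn (𝓞 K) v.asIdeal := by
  have hℓ : ℓ.Prime := hv ▸ (primesEquiv v).2
  have h := (NumberField.not_dvd_discr_iff_isUnramifiedIn K (𝓞 K) (Nat.prime_iff_prime_int.mp hℓ)).mp hℓd
  rw [Algebra.isUnramifiedIn_iff_forall_ramificationIdx_eq_one] at h ⊢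
  intro P _ hPv
  haveI := hPv
  rw [← ramificationIdx_int_eq hv P]
  exact h P ((liesOver_span_iff_natCast_mem hℓ P).mpr ((liesOver_asIdeal_iff_natCast_mem hv P).mp hPv))

/-- The multiplicity of a place `w ∣ ℓ` in `ℓ𝓞_K` is `1` when `v_ℓ` is unramified. [folklore] -/
theorem count_span_natCast_eq_one {v : HeightOneSpectrum (𝓞 ℚ)} {ℓ : ℕ} (hv : (primesEquiv v : ℕ) = ℓ)
    (hunr : Algebra.IsUnramifiedIn (𝓞 K) v.asIdeal) {w : HeightOneSpectrum (𝓞 K)} (hw : (ℓ : 𝓞 K) ∈ w.asIdeal) :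
    (Associates.mk w.asIdeal).count (Associates.mk (Ideal.span {(ℓ : 𝓞 K)})).factors = 1 := by
  have hℓ : ℓ.Prime := hv ▸ (primesEquiv v).2
  have h0 : Ideal.span {(ℓ : 𝓞 K)} ≠ ⊥ := by
    rw [Ne, Ideal.span_singleton_eq_bot]; exact_mod_cast hℓ.ne_zero
  haveI : w.asIdeal.LiesOver v.asIdeal := (liesOver_asIdeal_iff_natCast_mem hv w.asIdeal).mpr hw
  rw [Ideal.count_associates_factors_eq h0 w.isPrime w.ne_bot, ← map_asIdeal_eq_span_natCast hv,
    ← Ideal.IsDedekindDomain.ramificationIdx_eq_normalizedFactors_count v.asIdeal w.asIdeal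
      (by rw [map_asIdeal_eq_span_natCast hv]; exact h0)]
  exact hunr.ramificationIdx_eq_one inferInstance

/-- A place not above `ℓ` does not occur in `ℓ𝓞_K`. [folklore] -/
theorem count_span_natCast_eq_zero {ℓ : ℕ} (hℓ : ℓ.Prime) {w : HeightOneSpectrum (𝓞 K)}
    (hw : (ℓ : 𝓞 K) ∉ w.asIdeal) :
    (Associates.mk w.asIdeal).count (Associates.mk (Ideal.span {(ℓ : 𝓞 K)})).factors = 0 := by
  have h0 : Ideal.span {(ℓ : 𝓞 K)} ≠ ⊥ := by
    rw [Ne, Ideal.span_singleton_eq_bot]; exact_mod_cast hℓ.ne_zero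
  by_contra hne
  have hdvd : w.asIdeal ∣ Ideal.span {(ℓ : 𝓞 K)} :=
    (Associates.count_ne_zero_iff_dvd h0 w.irreducible).mp hne
  exact hw (Ideal.dvd_span_singleton.mp hdvd)

/-- `χ̃ᵥ((ℓ)) = ∏_{w ∋ ℓ} χᵥ(w)` when `v_ℓ` is unramified in `K`. [folklore] -/
theorem idealPow_span_natCast_eq_finprod {v : HeightOneSpectrum (𝓞 ℚ)} {ℓ : ℕ} (hv : (primesEquiv v : ℕ) = ℓ)
    (hunr : Algebra.IsUnramifiedIn (𝓞 K) v.asIdeal) (χv : HeightOneSpectrum (𝓞 K) → ℂ) :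
    idealPow K χv (Ideal.span {(ℓ : 𝓞 K)}) =
      ∏ᶠ w ∈ {w : HeightOneSpectrum (𝓞 K) | (ℓ : 𝓞 K) ∈ w.asIdeal}, χv w := by
  have hℓ : ℓ.Prime := hv ▸ (primesEquiv v).2
  unfold idealPow
  refine finprod_congr fun w => ?_
  rw [finprod_eq_if]
  simp only [Set.mem_setOf_eq]
  split_ifs with h
  · rw [count_span_natCast_eq_one hv hunr h, pow_one]
  · rw [count_span_natCast_eq_zero hℓ h, pow_zero]

/-- **The split criterion through places over `v_ℓ`**: for a quadratic field `K` and an odd prime `ℓ`, there are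
two places above `v_ℓ` iff `(d_K/ℓ) = 1`. [cite: Marcus2018, Ch. 3 Thm. 25] -/
theorem natCard_placesOver_eq_two_iff_jacobiSym (hK2 : Module.finrank ℚ K = 2) {v : HeightOneSpectrum (𝓞 ℚ)}
    {ℓ : ℕ} (hv : (primesEquiv v : ℕ) = ℓ) (hℓ2 : ℓ ≠ 2) :
    Nat.card {w : HeightOneSpectrum (𝓞 K) // w.under (𝓞 ℚ) = v} = 2 ↔ jacobiSym (NumberField.discr K) ℓ = 1 := by
  have hℓ : ℓ.Prime := hv ▸ (primesEquiv v).2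
  rw [natCard_placesOver_eq_ncard, ← primesOver_span_eq_primesOver_asIdeal hv]
  exact Literature.NumberTheory.QuadraticFields.Quadratic.ncard_primesOver_eq_two_iff_jacobiSym hK2 hℓ hℓ2

end Places

end Summit.BirchSwinnertonDyer.BirchSwinnertonDyer.Theorems.SmallImageLambdaLowerThreeNsThetaPartner

end
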